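import Summits.BirchSwinnertonDyer.BirchSwinnertonDyer.Theorems.CongruentShaFreeCutBDPUpToRigidityUnconditional
import Literature.NumberTheory.EllipticCurves.CastellaGrossiLeeSkinner2022.IMC2DivisibilityAndBDPValueFrame
import Literature.NumberTheory.QuadraticFields.KroneckerSplitting
import HarnessLib

set_option linter.dupNamespace false -- `Summit.BirchSwinnertonDyer.BirchSwinnertonDyer.Theorems.…` (summit = sub)
set_option autoImplicit false

/-!
# Route `CongruentShaFreeCut` (rung S2) — the ∀-FRAME value half AT GOOD PRIMES is citation-borne: PRINT
# (CGLS 2022 Thm. 5.1.3 / BDP 2013 Thm. 5.13, an ∃-frame statement) + LEMMA R ⟹ the value at 𝟙 of EVERY ♯-frame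

Cell `bsd-cn100`, prover seat `bsd-cn100-transfer` (g11); anchor for plan g15 RULING-3 (e2) (the named value half
`BDPWaldspurgerFormulaUpTo`, file `…BDPWaldspurgerFormula.lean`). Supports, does not close, stmt-BirchSwinnertonDyer-19079.
THEOREMS ONLY; imports no `Theses` module. PARTITION: none — RANK axis. HONEST FRAMING: a conditional theorem over the
tree's PUBLISHED named fact `CastellaGrossiLeeSkinner2022.thm513_exists_isBDPLFunction_valueAtOne` (`p ≠ 2`, `p ∤ N`;
nothing asserted); says nothing at an additive prime (`E_n` at `2`, `j = 0` at `3`), where the value half is OPEN.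

* **`valueAtOne_of_thm513_of_isBDPLFunctionUpTo`** — at a GOOD ODD split prime, the printed ∃-frame BDP formula
  gives the value at `𝟙` of EVERY ♯-frame `IsBDPLFunctionUpTo C' ι' v κ γ f_E Ω'_K Ω'_p 𝓛'` up to a non-zero constant:
  `𝓛'(𝟙) = u · c⁻² (1 − a_p p⁻¹ + p⁻¹)² (log_ω P_K)²`, `u = C'·u₀ ≠ 0`. The passage ∃-frame → ∀-frame is LEMMA R
  (`coe_constantCoeff_eq_mul_of_isBDPLFunctionUpTo`, MEMO-transfer-13 Thm 13.1 / ADD-A: `[T⁰]𝓛' = (C'/C)[T⁰]𝓛`).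
  This is the shape `BDPWaldspurgerFormulaUpTo p` names at every prime; at good odd `p` it is thus print + Lemma R,
  UP TO THE `a_p` VOCABULARY SEAM recorded below (R-IXT-1). It binds the declaration of record
  `thm513_exists_isBDPLFunction_valueAtOne`, which carries the cross-cell scope flag `CGLS22-Thm513-disc`
  (STRONGER-THAN-PRINT on (disc): CGLS §2's standing hypothesis «`D_K` odd and `D_K ≠ −3`» = BDP 2013 Assumption
  5.12 (3) is not a binder there), so as typed it inherits that flag; kept (kernel-true, conditional, 0 callers).
* **`valueAtOne_of_thm513disc_of_isBDPLFunctionUpTo`** (R-CITED-r09-1, appended 2026-08-27) — the SAME theorem fed by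
  the PRINT-FAITHFUL twin `thm513_exists_isBDPLFunction_valueAtOne_disc`, with the two (disc) binders
  `(hodd : Odd (NumberField.discr K)) (hd3 : NumberField.discr K ≠ -3)` after `hHN`; same proof, same conclusion —
  the consumer-facing form. On every level divisible by `2` (all the `E_n` frames, `N = 32n²`) the two binders are
  FREE under the Heegner hypothesis (`odd_discr_and_discr_ne_neg_three_of_heegner_of_two_dvd`: `2` split in `K` ⟺
  `d_K ≡ 1 (mod 8)`, tree theorem `Quadratic.ncard_primesOver_two_eq_two_iff`), whence the cost-zero form
  `valueAtOne_of_thm513disc_of_isBDPLFunctionUpTo_of_two_dvd` with `(h2N : 2 ∣ N)` in place of `hodd`, `hd3`.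

THE `a_p` VOCABULARY SEAM (R-IXT-1; referee Part IX-T ADJ-2, reads R1G22-5 / R2G48-5). The theorems of this file
display `a_p` as `W.frobeniusTrace p` (the print-side transcription of CGLS Thm. 5.1.3 on a globally minimal `W`),
whereas the named Prop `BDPWaldspurgerFormulaUpTo p` (file `…BDPWaldspurgerFormula.lean`) writes `E.LFunction p` and
the guard `[p ∤ N]·p⁻¹`. At a good prime the two agree by the tree BRIDGE
`Literature.NumberTheory.EllipticCurves.LFunction_apply_prime_eq_frobeniusTrace` (file `LFunctionPrimeCoeff.lean`;
hypothesis `W.HasGoodReductionAtPrime p`) composed with the GLUE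
`Literature.NumberTheory.EllipticCurves.hasGoodReductionAtPrime_of_not_dvd_conductorNorm` (file
`HidaFamilyMembersProofs.lean`; `¬ p ∣ N_E → good reduction at p`, with `E.conductorNorm ℤ = N` on the Prop's side)
and the guard evaluation `[p ∤ N] = 1` under `hpN`. NO theorem of this file crosses the two vocabularies: the one-line
reading theorem (FromPrint display → an instance of the Prop's display at good odd `p ∤ N`) is owed ONLY together with a
consumer that does (R-IXT-2), and is deliberately not here.

References: [CastellaGrossiLeeSkinner2022] Thm. 5.1.3 with §2 (Heeg)/(spl)/(disc); [BertoliniDarmonPrasanna2013] Thm. 5.13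
with Assumption 5.12 (3); [Castella2018] Thm. 3.1; [SilvermanAEC2009] Ex. 8.19(a) (the bridge); [Silverman1994] IV.10.2(a)
(the glue).
-/

noncomputable section

open scoped Classical

open PowerSeries WeierstrassCurve NumberField IsDedekindDomain Field Literature.NumberTheory.EllipticCurves
  Literature.NumberTheory.EllipticCurves.ModularForms Literature.NumberTheory.QuadraticFields
  Literature.NumberTheory.EllipticCurves.Castella2018
  Literature.NumberTheory.EllipticCurves.CastellaGrossiLeeSkinner2022
open Literature.NumberTheory.GaloisRepresentations
open Summit.BirchSwinnertonDyer.BirchSwinnertonDyer.Theorems.CongruentShaFreeCutBDPUpToRigidity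

namespace Summit.BirchSwinnertonDyer.BirchSwinnertonDyer.Theorems.CongruentShaFreeCutBDPWaldspurgerFromPrint

/-- **At a good odd split prime, the printed (∃-frame) BDP formula at 𝟙 gives the value at 𝟙 of EVERY ♯-frame,
up to a non-zero constant** — PRINT (`thm513_exists_isBDPLFunction_valueAtOne`: CGLS 2022 Thm. 5.1.3 / BDP 2013
Thm. 5.13 on a frame of `𝓛_E`, value `u₀ · c⁻² (1 − a_p p⁻¹ + p⁻¹)² (log_ω P_K)²` with `u₀ ∈ R₀ˣ`) + LEMMA R
(`coe_constantCoeff_eq_mul_of_isBDPLFunctionUpTo`: two ♯-frames of the same `(ι', v, κ, γ, f_E)` have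
`[T⁰]𝓛' = (C'/C)·[T⁰]𝓛`). Conditional on the named fact; nothing asserted.
[cite: CastellaGrossiLeeSkinner2022, Thm. 5.1.3 (shape; nothing asserted)] [cite: Castella2018, Thm. 3.1] -/
theorem valueAtOne_of_thm513_of_isBDPLFunctionUpTo (h513 : thm513_exists_isBDPLFunction_valueAtOne)
    {p : ℕ} [Fact p.Prime] (ι' : PadicAlgCl p ≃+* ℂ) (W : WeierstrassCurve ℚ) [W.IsElliptic]
    [W.IsGloballyMinimal] (K : Type) [Field K] [NumberField K] (v : HeightOneSpectrum (𝓞 K))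
    (κ : ZpExtension K p) (γ : absoluteGaloisGroup K) {N : ℕ} [NeZero N]
    (Dt : ModularParametrizationData W N) (H : HeegnerDatum N (NumberField.discr K))
    (w : InfinitePlace K) (e : K →+* ℚ_[p]) (P : (W.baseChange K).toAffine.Point)
    (hp2 : p ≠ 2) (hpN : ¬ p ∣ N) (hK : IsImaginaryQuadratic K)
    (hsplit : ((Ideal.span {(p : ℤ)}).primesOver (𝓞 K)).ncard = 2) (hv : ((p : ℕ) : 𝓞 K) ∈ v.asIdeal)
    (hι' : ∀ (w' : InfinitePlace K) (k : 𝓞 K), k ∈ v.asIdeal ↔ ‖ι'.symm (w'.embedding (k : K))‖ < 1)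
    (hHN : SatisfiesHeegnerHypothesis N K) (hκ : κ.IsAnticyclotomic) (hγ : κ.IsTopGenerator γ)
    (hP : WeierstrassCurve.Affine.Point.map w.embedding.toRatAlgHom P = heegnerPointComplex Dt H)
    (he : ∀ k : 𝓞 K, k ∈ v.asIdeal ↔ ‖e (k : K)‖ < 1)
    {ΩK' : ℂ} {Ωp' C' : ℂ_[p]} {L' : UnrSeries p} (hΩK' : ΩK' ≠ 0) (hΩp' : Ωp' ≠ 0) (hC' : C' ≠ 0)
    (hL' : IsBDPLFunctionUpTo C' ι' v κ γ Dt.f ΩK' Ωp' L') :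
    ∃ u : ℂ_[p], u ≠ 0 ∧ L'.HasValueAt 0
      (u * algebraMap ℚ_[p] ℂ_[p] (((Dt.c : ℚ_[p])⁻¹) ^ 2 *
          (1 - (W.frobeniusTrace p : ℚ_[p]) * (p : ℚ_[p])⁻¹ + (p : ℚ_[p])⁻¹) ^ 2 *
          (padicLogOmega W p e P) ^ 2)) := by
  obtain ⟨ΩK, Ωp, L, hΩK, hL, u₀, hval⟩ :=
    h513 ι' W K v κ γ Dt H w e P hp2 hpN hK hsplit hv hι' hHN hκ hγ hP he
  have hΩp : ((Ωp : unrIntegers p) : ℂ_[p]) ≠ 0 := fun h ↦ (Units.ne_zero Ωp) (Subtype.ext h)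
  have hLup : IsBDPLFunctionUpTo 1 ι' v κ γ Dt.f ΩK ((Ωp : unrIntegers p) : ℂ_[p]) L :=
    isBDPLFunctionUpTo_one_iff.mpr hL
  -- LEMMA R: `[T⁰]L' = (C'/1)·[T⁰]L`
  have hR := coe_constantCoeff_eq_mul_of_isBDPLFunctionUpTo hK hκ hγ hΩK hΩK' hΩp hΩp' one_ne_zero hC'
    hLup hL'
  rw [div_one] at hR
  -- the printed value of `L` at `𝟙` is its constant coefficient
  have h0 := UnrSeries.eq_constantCoeff_of_hasValueAt_zero hval
  have hu₀ : (((u₀ : unrIntegers p)) : ℂ_[p]) ≠ 0 := fun h ↦ (Units.ne_zero u₀) (Subtype.ext h)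
  refine ⟨C' * ((u₀ : unrIntegers p) : ℂ_[p]), mul_ne_zero hC' hu₀, ?_⟩
  have hval' := L'.hasValueAt_zero
  rw [hR, ← h0] at hval'
  simpa only [mul_assoc] using hval'

/-! ## R-CITED-r09-1 (2026-08-27): the print-faithful twin WITH CGLS §2's (disc), and its cost-zero form on the
## levels divisible by `2` (all the `E_n` frames) -/

/-- **At a good odd split prime, the printed (∃-frame) BDP formula at 𝟙 — in its PRINT-FAITHFUL form, i.e. under
CGLS §2's standing hypothesis (disc) «`D_K` odd and `D_K ≠ −3`» (= BDP 2013 Assumption 5.12 (3)) — gives the value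
at 𝟙 of EVERY ♯-frame, up to a non-zero constant.** The same statement and proof as
`valueAtOne_of_thm513_of_isBDPLFunctionUpTo`, fed by the corrected named fact
`thm513_exists_isBDPLFunction_valueAtOne_disc` with the two (disc) binders `hodd`, `hd3` inserted after `hHN`
(repair R-CITED-r09-1 of the cross-cell audit D-AUDIT-r09-ADDENDUM-4; kernel bytes of that sheet's K9′).
PRINT + LEMMA R (`coe_constantCoeff_eq_mul_of_isBDPLFunctionUpTo`). Conditional on the named fact; nothing asserted.
[cite: CastellaGrossiLeeSkinner2022, Thm. 5.1.3 with the standing hypotheses of §2 ((Heeg), (spl), (disc)) (shape; nothing asserted)]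
[cite: BertoliniDarmonPrasanna2013, Thm. 5.13 with Assumption 5.12 (3)] [cite: Castella2018, Thm. 3.1] -/
theorem valueAtOne_of_thm513disc_of_isBDPLFunctionUpTo (h513 : thm513_exists_isBDPLFunction_valueAtOne_disc)
    {p : ℕ} [Fact p.Prime] (ι' : PadicAlgCl p ≃+* ℂ) (W : WeierstrassCurve ℚ) [W.IsElliptic]
    [W.IsGloballyMinimal] (K : Type) [Field K] [NumberField K] (v : HeightOneSpectrum (𝓞 K))
    (κ : ZpExtension K p) (γ : absoluteGaloisGroup K) {N : ℕ} [NeZero N]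
    (Dt : ModularParametrizationData W N) (H : HeegnerDatum N (NumberField.discr K))
    (w : InfinitePlace K) (e : K →+* ℚ_[p]) (P : (W.baseChange K).toAffine.Point)
    (hp2 : p ≠ 2) (hpN : ¬ p ∣ N) (hK : IsImaginaryQuadratic K)
    (hsplit : ((Ideal.span {(p : ℤ)}).primesOver (𝓞 K)).ncard = 2) (hv : ((p : ℕ) : 𝓞 K) ∈ v.asIdeal)
    (hι' : ∀ (w' : InfinitePlace K) (k : 𝓞 K), k ∈ v.asIdeal ↔ ‖ι'.symm (w'.embedding (k : K))‖ < 1)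
    (hHN : SatisfiesHeegnerHypothesis N K)
    (hodd : Odd (NumberField.discr K)) (hd3 : NumberField.discr K ≠ -3)
    (hκ : κ.IsAnticyclotomic) (hγ : κ.IsTopGenerator γ)
    (hP : WeierstrassCurve.Affine.Point.map w.embedding.toRatAlgHom P = heegnerPointComplex Dt H)
    (he : ∀ k : 𝓞 K, k ∈ v.asIdeal ↔ ‖e (k : K)‖ < 1)
    {ΩK' : ℂ} {Ωp' C' : ℂ_[p]} {L' : UnrSeries p} (hΩK' : ΩK' ≠ 0) (hΩp' : Ωp' ≠ 0) (hC' : C' ≠ 0)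
    (hL' : IsBDPLFunctionUpTo C' ι' v κ γ Dt.f ΩK' Ωp' L') :
    ∃ u : ℂ_[p], u ≠ 0 ∧ L'.HasValueAt 0
      (u * algebraMap ℚ_[p] ℂ_[p] (((Dt.c : ℚ_[p])⁻¹) ^ 2 *
          (1 - (W.frobeniusTrace p : ℚ_[p]) * (p : ℚ_[p])⁻¹ + (p : ℚ_[p])⁻¹) ^ 2 *
          (padicLogOmega W p e P) ^ 2)) := by
  obtain ⟨ΩK, Ωp, L, hΩK, hL, u₀, hval⟩ :=
    h513 ι' W K v κ γ Dt H w e P hp2 hpN hK hsplit hv hι' hHN hodd hd3 hκ hγ hP he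
  have hΩp : ((Ωp : unrIntegers p) : ℂ_[p]) ≠ 0 := fun h ↦ (Units.ne_zero Ωp) (Subtype.ext h)
  have hLup : IsBDPLFunctionUpTo 1 ι' v κ γ Dt.f ΩK ((Ωp : unrIntegers p) : ℂ_[p]) L :=
    isBDPLFunctionUpTo_one_iff.mpr hL
  -- LEMMA R: `[T⁰]L' = (C'/1)·[T⁰]L`
  have hR := coe_constantCoeff_eq_mul_of_isBDPLFunctionUpTo hK hκ hγ hΩK hΩK' hΩp hΩp' one_ne_zero hC'
    hLup hL'
  rw [div_one] at hR
  -- the printed value of `L` at `𝟙` is its constant coefficient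
  have h0 := UnrSeries.eq_constantCoeff_of_hasValueAt_zero hval
  have hu₀ : (((u₀ : unrIntegers p)) : ℂ_[p]) ≠ 0 := fun h ↦ (Units.ne_zero u₀) (Subtype.ext h)
  refine ⟨C' * ((u₀ : unrIntegers p) : ℂ_[p]), mul_ne_zero hC' hu₀, ?_⟩
  have hval' := L'.hasValueAt_zero
  rw [hR, ← h0] at hval'
  simpa only [mul_assoc] using hval'

/-- **(disc) is FREE on every level divisible by `2` under the Heegner hypothesis.** If `K` is imaginary
quadratic, `2 ∣ N` and every prime factor of `N` splits in `K`, then `2` splits in `K`, so `d_K ≡ 1 (mod 8)` by the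
decomposition law at `2` (`Quadratic.ncard_primesOver_two_eq_two_iff`); in particular `d_K` is odd and `d_K ≠ −3`.
This is the case of every `E_n` frame (`N = 32n²`) and of every frame carrying `SatisfiesHeegnerHypothesis 2 K`
(the cell's `(spl)` at `p = 2`). Elementary; the cross-cell sheet's K3/K7. [folklore] -/
theorem odd_discr_and_discr_ne_neg_three_of_heegner_of_two_dvd {K : Type} [Field K] [NumberField K]
    (hK : IsImaginaryQuadratic K) {N : ℕ} (h2N : 2 ∣ N) (hHN : SatisfiesHeegnerHypothesis N K) :
    Odd (NumberField.discr K) ∧ NumberField.discr K ≠ -3 := by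
  have hspl : ((Ideal.span {(2 : ℤ)}).primesOver (𝓞 K)).ncard = 2 := by
    simpa using hHN 2 Nat.prime_two h2N
  have h8 : NumberField.discr K % 8 = 1 := (Quadratic.ncard_primesOver_two_eq_two_iff hK.1).mp hspl
  exact ⟨Int.odd_iff.mpr (by omega), by omega⟩

/-- **Cost-zero form on the levels divisible by `2`.** At a good odd split prime `p` of a curve whose level `N` is
EVEN (every `E_n`: `N = 32n²`), the print-faithful BDP formula at 𝟙 gives the value at 𝟙 of EVERY ♯-frame up to a
non-zero constant, with NO (disc) binder: `(h2N : 2 ∣ N)` and the Heegner hypothesis `hHN` supply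
`Odd (discr K)` and `discr K ≠ −3` (`odd_discr_and_discr_ne_neg_three_of_heegner_of_two_dvd`). So on the cell's own
frames the re-pointing to the (disc) twin costs nothing. Conditional on the named fact; nothing asserted.
[cite: CastellaGrossiLeeSkinner2022, Thm. 5.1.3 with the standing hypotheses of §2 (shape; nothing asserted)]
[cite: BertoliniDarmonPrasanna2013, Thm. 5.13 with Assumption 5.12 (3)] -/
theorem valueAtOne_of_thm513disc_of_isBDPLFunctionUpTo_of_two_dvd
    (h513 : thm513_exists_isBDPLFunction_valueAtOne_disc)
    {p : ℕ} [Fact p.Prime] (ι' : PadicAlgCl p ≃+* ℂ) (W : WeierstrassCurve ℚ) [W.IsElliptic]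
    [W.IsGloballyMinimal] (K : Type) [Field K] [NumberField K] (v : HeightOneSpectrum (𝓞 K))
    (κ : ZpExtension K p) (γ : absoluteGaloisGroup K) {N : ℕ} [NeZero N]
    (Dt : ModularParametrizationData W N) (H : HeegnerDatum N (NumberField.discr K))
    (w : InfinitePlace K) (e : K →+* ℚ_[p]) (P : (W.baseChange K).toAffine.Point)
    (hp2 : p ≠ 2) (hpN : ¬ p ∣ N) (h2N : 2 ∣ N) (hK : IsImaginaryQuadratic K)
    (hsplit : ((Ideal.span {(p : ℤ)}).primesOver (𝓞 K)).ncard = 2) (hv : ((p : ℕ) : 𝓞 K) ∈ v.asIdeal)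
    (hι' : ∀ (w' : InfinitePlace K) (k : 𝓞 K), k ∈ v.asIdeal ↔ ‖ι'.symm (w'.embedding (k : K))‖ < 1)
    (hHN : SatisfiesHeegnerHypothesis N K) (hκ : κ.IsAnticyclotomic) (hγ : κ.IsTopGenerator γ)
    (hP : WeierstrassCurve.Affine.Point.map w.embedding.toRatAlgHom P = heegnerPointComplex Dt H)
    (he : ∀ k : 𝓞 K, k ∈ v.asIdeal ↔ ‖e (k : K)‖ < 1)
    {ΩK' : ℂ} {Ωp' C' : ℂ_[p]} {L' : UnrSeries p} (hΩK' : ΩK' ≠ 0) (hΩp' : Ωp' ≠ 0) (hC' : C' ≠ 0)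
    (hL' : IsBDPLFunctionUpTo C' ι' v κ γ Dt.f ΩK' Ωp' L') :
    ∃ u : ℂ_[p], u ≠ 0 ∧ L'.HasValueAt 0
      (u * algebraMap ℚ_[p] ℂ_[p] (((Dt.c : ℚ_[p])⁻¹) ^ 2 *
          (1 - (W.frobeniusTrace p : ℚ_[p]) * (p : ℚ_[p])⁻¹ + (p : ℚ_[p])⁻¹) ^ 2 *
          (padicLogOmega W p e P) ^ 2)) :=
  have hdisc := odd_discr_and_discr_ne_neg_three_of_heegner_of_two_dvd hK h2N hHN
  valueAtOne_of_thm513disc_of_isBDPLFunctionUpTo h513 ι' W K v κ γ Dt H w e P hp2 hpN hK hsplit hv hι' hHN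
    hdisc.1 hdisc.2 hκ hγ hP he hΩK' hΩp' hC' hL'

end Summit.BirchSwinnertonDyer.BirchSwinnertonDyer.Theorems.CongruentShaFreeCutBDPWaldspurgerFromPrint

end
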